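import Literature.Analysis.Hypoelliptic.KernelOperators
import Literature.Analysis.Hypoelliptic.Pairing
import Mathlib.Analysis.Distribution.SchwartzSpace.Basic
import Mathlib.Analysis.Distribution.TemperateGrowth
import HarnessLib

/-!
# Schwartz functions in the Fourier-side toolkit: niceness, rapid decay, and testing

Analysis/Hypoelliptic support file serving the discharge of
`Literature.Analysis.Distribution.Hormander1967_thm11` (the interface between distributions and
the weighted-`L²` calculus).

* every Schwartz function is `Nice` (`SchwartzMap.nice`) and rapidly decreasing with explicit
  constants (`SchwartzMap.rapidDecay`);
* the Bessel weights `⟨ξ⟩^s` are multipliers of the Schwartz space (`bwSchwartz`);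
* **testing against Schwartz functions determines an `Ĥ^t` function**
  (`ae_eq_zero_of_forall_pairing_schwartz`, `ae_eq_of_forall_pairing_schwartz`): if
  `pairing G ψ = 0` for all `ψ ∈ 𝓢` then `G = 0` a.e. — the density of `𝓢` in `L²`
  (`SchwartzMap.denseRange_toLpCLM`) moved through the weight.

## References

* L. Hörmander, *The Analysis of Linear Partial Differential Operators I*, §7.1 (folklore).
-/

noncomputable section

open MeasureTheory Set Filter Function SchwartzMap
open scoped ENNReal NNReal Topology ComplexConjugate InnerProductSpace

namespace Literature.Analysis.Hypoelliptic

variable {V : Type*} [NormedAddCommGroup V] [InnerProductSpace ℝ V] [FiniteDimensional ℝ V]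
  [MeasurableSpace V] [BorelSpace V]

/-! ### The Bessel weights as Schwartz multipliers -/

omit [MeasurableSpace V] [BorelSpace V] [FiniteDimensional ℝ V] in
/-- `⟨·⟩^s` (as a complex function) has temperate growth. [folklore] -/
theorem hasTemperateGrowth_bwC (s : ℝ) : (fun ξ : V => (bw s ξ : ℂ)).HasTemperateGrowth := by
  have h := Function.hasTemperateGrowth_one_add_norm_sq_rpow V (s / 2)
  have e : (fun ξ : V => (bw s ξ : ℂ)) =
      (Complex.ofRealCLM : ℝ → ℂ) ∘ fun x : V => (1 + ‖x‖ ^ 2) ^ (s / 2) := rfl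
  rw [e]
  exact Complex.ofRealCLM.hasTemperateGrowth.comp h

/-- Multiplication by `⟨·⟩^s` on the Schwartz space. [folklore] -/
def bwSchwartz (s : ℝ) : 𝓢(V, ℂ) →L[ℂ] 𝓢(V, ℂ) :=
  SchwartzMap.smulLeftCLM ℂ (fun ξ : V => (bw s ξ : ℂ))

omit [MeasurableSpace V] [BorelSpace V] [FiniteDimensional ℝ V] in
/-- `bwSchwartz s ψ = ⟨·⟩^s ψ` pointwise. [folklore] -/
@[simp] theorem bwSchwartz_apply (s : ℝ) (ψ : 𝓢(V, ℂ)) (ξ : V) :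
    bwSchwartz s ψ ξ = (bw s ξ : ℂ) * ψ ξ := by
  unfold bwSchwartz
  rw [SchwartzMap.smulLeftCLM_apply_apply (hasTemperateGrowth_bwC s)]
  rfl

/-! ### Schwartz functions are nice and rapidly decreasing -/

/-- **Every Schwartz function is `Nice`.** [folklore] -/
theorem SchwartzMap.nice (ψ : 𝓢(V, ℂ)) : Nice (ψ : V → ℂ) := by
  refine ⟨ψ.continuous.aestronglyMeasurable, fun t => ?_⟩
  have h := (bwSchwartz t ψ).memLp 2 (volume : Measure V)
  have e : ((bwSchwartz t ψ : 𝓢(V, ℂ)) : V → ℂ) = fun ξ => (bw t ξ : ℂ) * ψ ξ := by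
    ext ξ; exact bwSchwartz_apply t ψ ξ
  unfold wnorm
  rw [← e]
  exact h.2

omit [InnerProductSpace ℝ V] [MeasurableSpace V] [BorelSpace V] [FiniteDimensional ℝ V] in
/-- `⟨ξ⟩^N ≤ (1 + ‖ξ‖)^N`. [folklore] -/
theorem bw_natCast_le (N : ℕ) (ξ : V) : bw N ξ ≤ (1 + ‖ξ‖) ^ N := by
  induction N with
  | zero => simp
  | succ N ih =>
    rw [Nat.cast_succ, bw_add, pow_succ]
    exact mul_le_mul ih (bw_one_le ξ) (bw_nonneg 1 ξ) (by positivity)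

omit [FiniteDimensional ℝ V] in
/-- **Every Schwartz function is rapidly decreasing**, with constants from its seminorms. [folklore] -/
theorem SchwartzMap.rapidDecay (ψ : 𝓢(V, ℂ)) :
    RapidDecay (ψ : V → ℂ) (fun N => 2 ^ N *
      (Finset.Iic (N, 0)).sup (fun m => SchwartzMap.seminorm ℂ m.1 m.2) ψ) where
  measurable := ψ.continuous.measurable
  nonneg N := by positivity
  bound N ζ := by
    have h := SchwartzMap.one_add_le_sup_seminorm_apply (𝕜 := ℂ) (m := (N, 0)) (k := N) (n := 0)
      le_rfl le_rfl ψ ζ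
    rw [norm_iteratedFDeriv_zero] at h
    have hb := bw_natCast_le N ζ
    have hbpos : 0 < bw N ζ := bw_pos _ ζ
    rw [bw_neg, ← div_eq_mul_inv, le_div_iff₀ hbpos]
    calc ‖ψ ζ‖ * bw N ζ ≤ ‖ψ ζ‖ * (1 + ‖ζ‖) ^ N := mul_le_mul_of_nonneg_left hb (norm_nonneg _)
      _ = (1 + ‖ζ‖) ^ N * ‖ψ ζ‖ := mul_comm _ _
      _ ≤ _ := h

/-! ### Testing against Schwartz functions -/

/-- The weighted function `⟨·⟩^t G` of an `Ĥ^t` function is in `L²`. [folklore] -/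
theorem InH.memLp_bw_mul {t : ℝ} {G : V → ℂ} (hG : InH t G) :
    MemLp (fun ξ => (bw t ξ : ℂ) * G ξ) 2 volume :=
  ⟨(Complex.continuous_ofReal.comp (continuous_bw t)).aestronglyMeasurable.mul hG.1, hG.2⟩

/-- **An `Ĥ^t` function testing to zero against all Schwartz functions vanishes a.e.**
[folklore] -/
theorem ae_eq_zero_of_forall_pairing_schwartz {t : ℝ} {G : V → ℂ} (hG : InH t G)
    (h : ∀ ψ : 𝓢(V, ℂ), pairing G ψ = 0) : G =ᵐ[volume] 0 := by
  -- `H = ⟨·⟩^t G ∈ L²` is orthogonal to every Schwartz function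
  set H : Lp ℂ 2 (volume : Measure V) := hG.memLp_bw_mul.toLp _ with hH
  have hHf : (H : V → ℂ) =ᵐ[volume] fun ξ => (bw t ξ : ℂ) * G ξ := hG.memLp_bw_mul.coeFn_toLp
  have horth : ∀ ψ : 𝓢(V, ℂ), ⟪(SchwartzMap.toLpCLM ℝ ℂ 2 (volume : Measure V)) ψ, H⟫_ℂ = 0 := by
    intro ψ
    rw [MeasureTheory.L2.inner_def]
    have e : (fun ξ => ⟪((SchwartzMap.toLpCLM ℝ ℂ 2 (volume : Measure V)) ψ : V → ℂ) ξ, (H : V → ℂ) ξ⟫_ℂ)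
        =ᵐ[volume] fun ξ => (bw t ξ : ℂ) * G ξ * conj (ψ ξ) := by
      have h1 := (ψ.coeFn_toLp 2 (volume : Measure V))
      filter_upwards [hHf, h1] with ξ hξ h1ξ
      rw [SchwartzMap.toLpCLM_apply] at *
      rw [hξ, h1ξ]
      simp only [RCLike.inner_apply']
      ring
    rw [integral_congr_ae e]
    -- this is `pairing G (⟨·⟩^t ψ)`
    have h2 := h (bwSchwartz t ψ)
    unfold pairing at h2
    rw [← h2]
    refine integral_congr_ae (Eventually.of_forall fun ξ => ?_)
    simp only [bwSchwartz_apply, map_mul, Complex.conj_ofReal]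
    ring
  -- density of `𝓢` in `L²`
  have hdense := SchwartzMap.denseRange_toLpCLM (F := ℂ) (p := (2 : ℝ≥0∞)) (μ := (volume : Measure V))
    ENNReal.ofNat_ne_top
  have hzero : ∀ f : Lp ℂ 2 (volume : Measure V), ⟪f, H⟫_ℂ = 0 := by
    intro f
    have hc : Continuous fun f : Lp ℂ 2 (volume : Measure V) => ⟪f, H⟫_ℂ := continuous_id.inner continuous_const
    have := hdense.equalizer hc continuous_const (funext horth)
    exact congrFun this f
  have hH0 : H = 0 := inner_self_eq_zero.1 (hzero H)
  -- back to functions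
  have hHae : (fun ξ => (bw t ξ : ℂ) * G ξ) =ᵐ[volume] 0 := by
    refine hHf.symm.trans ?_
    rw [hH0]
    exact Lp.coeFn_zero ℂ 2 volume
  filter_upwards [hHae] with ξ hξ
  simp only [Pi.zero_apply, mul_eq_zero, Complex.ofReal_eq_zero] at hξ ⊢
  exact hξ.resolve_left (bw_pos t ξ).ne'

/-- Two `Ĥ^t` functions with the same pairings against all Schwartz functions agree a.e.
[folklore] -/
theorem ae_eq_of_forall_pairing_schwartz {t t' : ℝ} {G G' : V → ℂ} (hG : InH t G) (hG' : InH t' G')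
    (h : ∀ ψ : 𝓢(V, ℂ), pairing G ψ = pairing G' ψ) : G =ᵐ[volume] G' := by
  have hD : InH (min t t') (fun ξ => G ξ - G' ξ) := (hG.mono (min_le_left _ _)).sub (hG'.mono (min_le_right _ _))
  have h0 := ae_eq_zero_of_forall_pairing_schwartz hD fun ψ => by
    rw [pairing_sub_left (hG.mono (min_le_left _ _)) (hG'.mono (min_le_right _ _))
      ((SchwartzMap.nice ψ).inH _), h ψ, sub_self]
  filter_upwards [h0] with ξ hξ
  simpa [sub_eq_zero] using hξ

end Literature.Analysis.Hypoelliptic
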